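import Literature.MathematicalPhysics.QuantumFieldTheory.Balaban1983to89.B8Ineq159CurvedCubeMemberPerCube
import Literature.MathematicalPhysics.QuantumFieldTheory.Balaban1983to89.B8Ineq159TowerNearFlat
import Literature.MathematicalPhysics.QuantumFieldTheory.Balaban1983to89.B7Eq43AveragedSmallness

/-!
# `Balaban1983to89.B8Ineq159CurvedCubeMemberPerCubeTower` — [Balaban1985RegularSpaces] (1.59) p. 86 AT A CURVED BACKGROUND ON THE CUBE MEMBER `{□_j}`
# OF (1.131), PER MEMBER, EVERY TRUNCATION `1 ≤ m ≤ k`, in [Balaban1985Averaging] Prop. 2's AVERAGING-CLOSED REGIME: for every background `U₀` with values in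
# an averaging-closed subgroup `G ⊆ U1` and `‖U₀(b) − 1‖ ≤ δ₀(□, m)`, every `𝔸`-valued bond function in the CURVED Landau gauge (1.38) of `U₀` at truncation `m`:
# the curved data — current `J_{U₀}`, averages `Q_j(U₀)` (`j ≤ m`) over print's class, outer layer — dominate `|φ|`, `|D^η_{U₀}φ|`, `|Δ^η_{U₀}φ|` on the sides of
# `□_j` with a member-dependent constant (the all-truncations edition of `B8Ineq159CurvedCubeMemberPerCube`)

statement-level skeleton of published theorems with citation tags; proofs where landed; nothing here is a claim about the
Yang–Mills mass gap

`[Balaban1985RegularSpaces]` ("B8", CMP **99** (1985) 75–102) (1.59) p. 86, (1.62) p. 87, (1.29) p. 81, (1.31) p. 82, (1.38) p. 82, (1.68) p. 88, (1.131) p. 99;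
`[Balaban1985BackgroundPropagators]` ("[4]", CMP **99** (1985) 389–434) Thm 3.3 p. 399, (3.19) p. 393, (3.23)–(3.25) p. 394, (3.79) p. 406;
`[Balaban1985Averaging]` ("B7", CMP **98** (1985) 17–51) Prop. 2 (52)–(54) p. 26, (43) p. 24, (122)–(127) pp. 36–37; `[Balaban1984PropagatorsII]` ("B6") (2.11) p. 225.
PDF held: `paper:balaban1985-cmp99-regular-spaces-gauge-fixing` (journal page = PDF page + 74).

CITATION HEADER (lean-in-tree rule).  Cell `pub-ymgap` (YM Track A, HUMAN RULING D-0062 ∕ D-0149), DAG node N05 = [B8], width seat `pub-ymgap-dag-n05-w3`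
(g2), CLAIM-1 file (D′).  WHY.  File (D) (`exists_curved159_perCube_truncOne`) is the truncation-`m = 1` edition, where the transpose `Q′(U₀)ᵀ` and the
averages are ONE step.  At truncation `m ≥ 2` they iterate through the averaged backgrounds `Ū₀ⁱ`, `i < m` ([B7] (43)); file (C′) (`B8Ineq159TowerNearFlat`)
ran the two inductions under the displayed per-level smallness `Ū₀ⁱ(b) ∈ U1`, `‖Ū₀ⁱ(b) − 1‖ ≤ ε̄`.  THIS FILE discharges that smallness from [B7] Prop. 2's
regime — `U₀` valued in an averaging-closed subgroup `G ⊆ U1` (`B7Prop2Explicit.AvgClosed`, `avgIter_mem`: every `Ū₀ⁱ ∈ G` once `pdev U₀ < α₀L^{−2m}`, here from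
`‖U₀(b) − 1‖ ≤ δ₀` by `B7Eq43AveragedSmallness.pdev_le_of_bonds`) and `‖Ū₀ⁱ(b) − 1‖ ≤ (8(d+1)L)ⁱδ₀` (`B7Eq43AveragedSmallness.norm_avgIter_sub_one_le`) — and
re-runs file (D)'s bootstrap at truncation `m` with file (B)'s residual-tolerant flat estimate at `m`.

THE MATHEMATICS (kernel-checked; `𝔸` a finite-dimensional complete normed `ℂ`-algebra; `d ≥ 2`, `L ≥ 2`, `η > 0`, cube datum `(a, M, ρ, k)`, `1 ≤ m ≤ k`,
`G` averaging-closed).  ★★★ `exists_curved159_perCube`: THERE ARE `δ₀ > 0` and `B′ > 0` (depending on the member, `m` and `𝔸`) such that for every background `U₀`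
with `U₀(b) ∈ G` and `‖U₀(b) − 1‖ ≤ δ₀` on all bonds, every `𝔸`-valued `φ` in the curved Landau gauge `IsLandau138 L m η □₀ (cubeLamS … m) U₀ φ` vanishing on the
bonds that side-touch no `□_j` (`j ≤ m`), and every `N ≥ 0` bounding (i) `(Lʲη)³|J_{U₀}(φ)|` on the bonds of `□_j`, (ii) the CURVED averages
`|Lʲη·Q_j(U₀)(iηφ)(c)|` on print's class `cubeLamBP … m j`, (iii) `η|φ|` on the outer layer: on every bond side-touching `□_j` (`j ≤ m`) `(Lʲη)|φ| ≤ B′N`,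
`(Lʲη)²|D^η_{U₀,ν}φ_τ| ≤ B′N`, `(Lʲη)³|Δ^η_{U₀}φ_τ| ≤ B′N`.  Window: `δ₀ ≤ min{1∕(128(d+1)²L·P), 1∕(32P), α₀L^{−2m}∕8, 1∕(2KC₀+2)}`, `P = (8(d+1)L)^m`,
`α₀ = min{1∕(3C₀(d)), c₂′(d,L)∕2}` ([B7] Prop. 2's thresholds `B7Prop2Explicit.C0 ∕ c2'`).

HONEST SCOPE ∕ A6.  (i) PER MEMBER and per truncation: `δ₀, B′` depend on `(□, m, 𝔸)` through file (B)'s non-explicit constant — NOT print's uniform `B₀(d, L)`,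
NOT [4] Thm 3.3, nothing of the random-walk expansion.  (ii) Closeness `‖U₀(b) − 1‖ ≤ δ₀` on ALL bonds in the given gauge and `U₀` valued in an averaging-closed
`G` — NOT the gauge-invariant class `InAk(α₀)` of the sockets; NOT an inhabitant of `SockB9P3` ∕ `SockH59` as typed.  (iii) At the record (`𝔸 = M₂(ℂ)`,
`G = SU(2)`) the averaging-closed hypothesis is the tree's `B7AvgClosedSpecialUnitary*` matter, not asserted here.  (iv) What it IS: the curved (1.59) data over
print's class at every truncation `1 ≤ m ≤ k` have no zero mode near `U₀ = 1` at any cube member, with a quantitative domination — an A6 witness for the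
`m ≥ 1` content of the N05 sockets beyond the flat model.  Count-neutral; N05 NOT discharged; no count claim; one finite `𝕋⁴` programme at fixed `ε`, Bałaban as
printed; the YM mass gap (Clay) is NOT proved by any of this — R4 closes the conditional finite-`𝕋⁴` rung `BalabanLadder.UV` only; nothing continuum ∕ ℝ⁴ ∕ OS.
No `sorry`, no `def`, no `instance`, no `notation`; `set_option maxHeartbeats 800000` for the one assembly proof (four times the default; ~60 named estimates).
Unit `pub-ymgap-dag-n05-w3` (g2), 2026-08-28.
-/

noncomputable section

namespace Literature.MathematicalPhysics.QuantumFieldTheory.Balaban1983to89.B8Ineq159CurvedCubeMemberPerCubeTower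

open B7Prop1Explicit B7Prop2Explicit B7Prop1Local
open B7Prop4GeneralLevels (linCovIter)
open B8Ineq132 (covDerivFwd covDeriv BondTouches)
open B8Eq140Level (SideTouches)
open B8Eq146AExpansion (iEta)
open B8Eq155JBound (Jcur)
open B8Eq138LandauZd (IsLandau138 covLap covDivB QT QprimeT)
open B8Eq131CubesAdmissible (cubeFam)
open B8CubeMemberZd (cubeLamS)
open B8Ineq159FlatCubeMemberPrinted (cubeLamBP)
open B8Ineq159FlatCubeMemberPerCube (sideTouches_pairs_finite)
open B8Ineq159FlatCubeMemberResidual (exists_bound_flat_residual_perCube cubeLamS_pairs_finite)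
open B8Ineq159StencilsNearFlat (norm_covDerivFwd_sub_flat_le norm_Jcur_sub_flat_le norm_covLap_sub_flat_le norm_landauStencil_sub_flat_le)
open B8Ineq159TowerNearFlat (norm_QT_sub_flat_le norm_linCovIter_sub_flat_le)
open B8Ineq159CurvedCubeMemberPerCube (QT_congr_on)

export B7Prop1Explicit (Site)

variable {d : ℕ} {𝔸 : Type*} [NormedRing 𝔸] [NormOneClass 𝔸] [NormedAlgebra ℂ 𝔸] [CompleteSpace 𝔸]

set_option maxHeartbeats 800000 in
-- one long assembly proof (the bootstrap carries ~60 named estimates); four times the default budget, no `decide` ∕ heavy automation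
/-- ★★★ **(1.59) AT A CURVED BACKGROUND ON THE CUBE MEMBER, PER MEMBER, EVERY TRUNCATION `1 ≤ m ≤ k`, AVERAGING-CLOSED REGIME.**  See the module docstring:
`δ₀ > 0`, `B′ > 0` depending on `(□, m, 𝔸)`; `U₀` valued in an averaging-closed `G ⊆ U1` ([B7] Prop. 2) and `δ₀`-close to `1` bondwise; `φ` in the curved Landau
gauge (1.38) at truncation `m`, supported on the side-touching bonds; data (i) `(Lʲη)³|J_{U₀}φ|`, (ii) `|Lʲη·Q_j(U₀)(iηφ)|` on print's class, (iii) outer layer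
`≤ N` ⇒ `(Lʲη)|φ|, (Lʲη)²|D^η_{U₀}φ|, (Lʲη)³|Δ^η_{U₀}φ| ≤ B′N` on the sides of `□_j`, `j ≤ m`.  PROOF: file (B) at `(φ, μ↾)` with `μ` the curved multiplier; files
(C)∕(C′) price flat-vs-curved data by `δ₀·(Σ|φ| + Σ|μ|)` (the tower letters discharged by `avgIter_mem` ∕ `norm_avgIter_sub_one_le` ∕ `pdev_le_of_bonds`); linear
bootstrap.  HONEST SCOPE: per member, non-explicit constants, not `InAk`, not a socket inhabitant, not [4] Thm 3.3.
[cite: Balaban1985RegularSpaces, (1.59) p.86, (1.62) p.87, (1.29) p.81, (1.31) p.82, (1.38) p.82, (1.68) p.88, (1.131) p.99; Balaban1985BackgroundPropagators, Thm 3.3 p.399, (3.19) p.393, (3.24)–(3.25) p.394, (3.79) p.406; Balaban1985Averaging, Prop. 2 (52)–(54) p.26, (43) p.24, (122)–(127) pp.36–37; Balaban1984PropagatorsII, (2.11) p.225] -/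
theorem exists_curved159_perCube [FiniteDimensional ℂ 𝔸] (hd2 : 2 ≤ d) {L : ℕ} (hL2 : 2 ≤ L) {η : ℝ} (hη : 0 < η)
    {G : Subgroup 𝔸ˣ} (hG : AvgClosed d L G) (a : Site d) (M ρ : ℕ) {k m : ℕ} (hm1 : 1 ≤ m) (hmk : m ≤ k) :
    ∃ δ₀ B' : ℝ, 0 < δ₀ ∧ 0 < B' ∧ ∀ (U₀ : Site d → Fin d → 𝔸ˣ), (∀ x κ, U₀ x κ ∈ G) →
      (∀ x κ, ‖((U₀ x κ : 𝔸ˣ) : 𝔸) - 1‖ ≤ δ₀) →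
      ∀ φ : Site d → Fin d → 𝔸,
        IsLandau138 L m η (cubeFam false L a M ρ k 0) (cubeLamS L a M ρ k m) U₀ φ →
        (∀ (y : Site d) (τ : Fin d), (∀ j, j ≤ m → ¬ SideTouches (cubeFam false L a M ρ k j) y τ) → φ y τ = 0) →
        ∀ N : ℝ, 0 ≤ N →
          (∀ j, j ≤ m → ∀ (y : Site d) (τ : Fin d), BondTouches (cubeFam false L a M ρ k j) y τ →
              ((L : ℝ) ^ j * η) ^ 3 * ‖Jcur η U₀ φ τ y‖ ≤ N) →
          (∀ j, j ≤ m → ∀ c ∈ cubeLamBP L a M ρ k m j, ‖linCovIter L U₀ (iEta η φ) j c.1 c.2‖ ≤ N) →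
          (∀ (y : Site d) (τ : Fin d), ¬ BondTouches (cubeFam false L a M ρ k 0) y τ → η * ‖φ y τ‖ ≤ N) →
          ∀ j, j ≤ m → ∀ (y : Site d) (τ : Fin d), SideTouches (cubeFam false L a M ρ k j) y τ →
            ((L : ℝ) ^ j * η) * ‖φ y τ‖ ≤ B' * N ∧
            (∀ ν : Fin d, ((L : ℝ) ^ j * η) ^ 2 * ‖covDerivFwd η U₀ ν (fun z => φ z τ) y‖ ≤ B' * N) ∧
            ((L : ℝ) ^ j * η) ^ 3 * ‖covLap η U₀ (fun z => φ z τ) y‖ ≤ B' * N := by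
  classical
  have hL : 1 ≤ L := le_trans (by norm_num) hL2
  obtain ⟨B, hB, H⟩ := exists_bound_flat_residual_perCube (𝔸 := 𝔸) hd2 hL hη a M ρ (k := k) (m := m) hm1 hmk
  -- finite index sets: side-touching bonds (targets ∕ support), restriction-set sites (multiplier)
  set TS := (sideTouches_pairs_finite L a M ρ hmk).toFinset with hTS
  set TM := (cubeLamS_pairs_finite L a M ρ k m).toFinset with hTM
  have memTS : ∀ {j y τ}, j ≤ m → SideTouches (cubeFam false L a M ρ k j) y τ → (j, (y, τ)) ∈ TS := fun hj hs => by
    rw [hTS, Set.Finite.mem_toFinset]; exact ⟨hj, hs⟩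
  have memTM : ∀ {j y}, j ≤ m → y ∈ cubeLamS L a M ρ k m j → (j, y) ∈ TM := fun hj hy => by
    rw [hTM, Set.Finite.mem_toFinset]; exact ⟨hj, hy⟩
  -- constants
  have hL0 : (0 : ℝ) < L := by exact_mod_cast hL
  have hL1 : (1 : ℝ) ≤ L := by exact_mod_cast hL
  have hd : (0 : ℝ) ≤ d := Nat.cast_nonneg d
  have hη0 : 0 ≤ η := hη.le
  -- the tower amplification `P = (8(d+1)L)^m` ([B7] (43): `‖Ū₀ⁱ(b) − 1‖ ≤ P·δ₀`) and the level growth `(2L)^m` of the averages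
  obtain ⟨P, hP⟩ : ∃ P : ℝ, P = (8 * ((d : ℝ) + 1) * L) ^ m := ⟨_, rfl⟩
  have hP1 : 1 ≤ P := by
    rw [hP]; exact one_le_pow₀ (by nlinarith [show (1 : ℝ) ≤ L by exact_mod_cast hL, show (0 : ℝ) ≤ d from Nat.cast_nonneg d])
  have hP0 : 0 < P := by linarith
  obtain ⟨C₁, hC₁⟩ : ∃ C₁ : ℝ,
      C₁ = 24 * d ^ 2 * (η ^ 3)⁻¹ + ((L : ℝ) ^ m * η) ^ 3 * (32 * d * (η ^ 2)⁻¹)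
        + (m : ℝ) * (102 * ((d : ℝ) + 1) ^ 2 * L * P) * (2 * (L : ℝ)) ^ m * η := ⟨_, rfl⟩
  obtain ⟨C₂, hC₂⟩ : ∃ C₂ : ℝ, C₂ = (m : ℝ) * (m + 1) * (2 * (d * L * P)) := ⟨_, rfl⟩
  obtain ⟨C₀, hC₀⟩ : ∃ C₀ : ℝ, C₀ = C₁ + C₂ := ⟨_, rfl⟩
  have hC₁0 : 0 ≤ C₁ := by rw [hC₁]; positivity
  have hC₂0 : 0 ≤ C₂ := by rw [hC₂]; positivity
  have hC₀0 : 0 ≤ C₀ := by rw [hC₀]; positivity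
  obtain ⟨K, hK⟩ : ∃ K : ℝ, K = (TS.card : ℝ) * η⁻¹ * B + (TM.card : ℝ) * B := ⟨_, rfl⟩
  have hK0 : 0 ≤ K := by rw [hK]; positivity
  -- [B7] Prop. 2's window for the averaged backgrounds to stay in `G ⊆ U1`
  obtain ⟨α₀, hα₀⟩ : ∃ α₀ : ℝ, α₀ = min (1 / (3 * C0 d)) (c2' d L / 2) := ⟨_, rfl⟩
  have hC0pos := B7Prop2Explicit.C0_pos d
  have hc2pos := B7Prop2Explicit.c2'_pos d L hL
  have hα₀pos : 0 < α₀ := by rw [hα₀]; exact lt_min (by positivity) (by positivity)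
  have hα3 : C0 d * α₀ ≤ 1 / 3 := by
    have h : α₀ ≤ 1 / (3 * C0 d) := by rw [hα₀]; exact min_le_left _ _
    calc C0 d * α₀ ≤ C0 d * (1 / (3 * C0 d)) := mul_le_mul_of_nonneg_left h hC0pos.le
      _ = 1 / 3 := by field_simp
  have hα2 : 2 * α₀ ≤ c2' d L := by
    have h : α₀ ≤ c2' d L / 2 := by rw [hα₀]; exact min_le_right _ _
    linarith
  obtain ⟨δ₁, hδ₁⟩ : ∃ δ₁ : ℝ, δ₁ = min (min (1 / (128 * ((d : ℝ) + 1) ^ 2 * L * P)) (1 / (32 * P)))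
      (α₀ * ((((L : ℝ) ^ m)⁻¹) ^ 2) / 8) := ⟨_, rfl⟩
  have hδ₁pos : 0 < δ₁ := by rw [hδ₁]; exact lt_min (lt_min (by positivity) (by positivity)) (by positivity)
  obtain ⟨δ₀, hδ₀⟩ : ∃ δ₀ : ℝ, δ₀ = min δ₁ (1 / (2 * K * C₀ + 2)) := ⟨_, rfl⟩
  have hδ₀pos : 0 < δ₀ := by rw [hδ₀]; exact lt_min hδ₁pos (by positivity)
  have hδ0 : (0 : ℝ) ≤ δ₀ := hδ₀pos.le
  have hδ₀δ₁ : δ₀ ≤ δ₁ := by rw [hδ₀]; exact min_le_left _ _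
  have hδ₀1 : 128 * ((d : ℝ) + 1) ^ 2 * L * (P * δ₀) ≤ 1 := by
    have h : δ₀ ≤ 1 / (128 * ((d : ℝ) + 1) ^ 2 * L * P) :=
      hδ₀δ₁.trans (by rw [hδ₁]; exact (min_le_left _ _).trans (min_le_left _ _))
    have hpos : 0 < 128 * ((d : ℝ) + 1) ^ 2 * L * P := by positivity
    calc 128 * ((d : ℝ) + 1) ^ 2 * L * (P * δ₀) = 128 * ((d : ℝ) + 1) ^ 2 * L * P * δ₀ := by ring
      _ ≤ 128 * ((d : ℝ) + 1) ^ 2 * L * P * (1 / (128 * ((d : ℝ) + 1) ^ 2 * L * P)) := mul_le_mul_of_nonneg_left h hpos.le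
      _ = 1 := by rw [one_div, mul_inv_cancel₀ hpos.ne']
  have hδ₀32 : P * δ₀ ≤ 1 / 32 := by
    have h : δ₀ ≤ 1 / (32 * P) := hδ₀δ₁.trans (by rw [hδ₁]; exact (min_le_left _ _).trans (min_le_right _ _))
    have hpos : (0 : ℝ) < 32 * P := by positivity
    calc P * δ₀ ≤ P * (1 / (32 * P)) := mul_le_mul_of_nonneg_left h hP0.le
      _ = 1 / 32 := by field_simp
  have hδ₀pd : 4 * δ₀ < α₀ * (((L : ℝ) ^ m)⁻¹) ^ 2 := by
    have h : δ₀ ≤ α₀ * ((((L : ℝ) ^ m)⁻¹) ^ 2) / 8 := hδ₀δ₁.trans (by rw [hδ₁]; exact min_le_right _ _)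
    have hpos : 0 < α₀ * (((L : ℝ) ^ m)⁻¹) ^ 2 := by positivity
    linarith
  have hδ₀2 : K * C₀ * δ₀ ≤ 1 / 2 := by
    have h : δ₀ ≤ 1 / (2 * K * C₀ + 2) := by rw [hδ₀]; exact min_le_right _ _
    have hpos : 0 < 2 * K * C₀ + 2 := by positivity
    have hKC : 0 ≤ K * C₀ := mul_nonneg hK0 hC₀0
    calc K * C₀ * δ₀ ≤ K * C₀ * (1 / (2 * K * C₀ + 2)) := mul_le_mul_of_nonneg_left h hKC
      _ = K * C₀ / (2 * K * C₀ + 2) := by ring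
      _ ≤ 1 / 2 := by rw [div_le_iff₀ hpos]; nlinarith
  have hδ₀le1 : δ₀ ≤ 1 := by
    have h32 : (1 : ℝ) / 32 ≤ 1 := by norm_num
    have : δ₀ ≤ P * δ₀ := le_mul_of_one_le_left hδ0 hP1
    linarith
  obtain ⟨B', hB'⟩ : ∃ B' : ℝ, B' = 2 * B + (4 * ((L : ℝ) ^ m) ^ 2 * η + 16 * d * ((L : ℝ) ^ m) ^ 3 * η) * K + 1 := ⟨_, rfl⟩
  have hB'pos : 0 < B' := by rw [hB']; positivity
  have hB'ge : 2 * B + (4 * ((L : ℝ) ^ m) ^ 2 * η + 16 * d * ((L : ℝ) ^ m) ^ 3 * η) * K ≤ B' := by rw [hB']; linarith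
  have hKterm : 0 ≤ (4 * ((L : ℝ) ^ m) ^ 2 * η + 16 * d * ((L : ℝ) ^ m) ^ 3 * η) * K := by positivity
  refine ⟨δ₀, B', hδ₀pos, hB'pos, ?_⟩
  intro U₀ hUG hδ φ hLan hs N hN h1 h2 h3
  have hU : ∀ x κ, U₀ x κ ∈ U1 𝔸 := fun x κ => hG.le_U1 (hUG x κ)
  -- the averaged backgrounds `Ū₀ⁱ`, `i < m`: in `G ⊆ U1` ([B7] Prop. 2, `avgIter_mem`) and `P·δ₀`-close to `1` (`norm_avgIter_sub_one_le`)
  have hpdev : pdev U₀ < α₀ * (((L : ℝ) ^ m)⁻¹) ^ 2 :=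
    (B7Eq43AveragedSmallness.pdev_le_of_bonds hU hδ0 hδ).trans_lt hδ₀pd
  have hmem := avgIter_mem L hL2 hG m U₀ hUG hα₀pos hα3 hα2 hpdev
  have hUi : ∀ i, i < m → ∀ (x : Site d) (κ : Fin d), avgIter L U₀ i x κ ∈ U1 𝔸 :=
    fun i hi x κ => hG.le_U1 (hmem i hi.le x κ)
  have hεi : ∀ i, i < m → ∀ (x : Site d) (κ : Fin d), ‖((avgIter L U₀ i x κ : 𝔸ˣ) : 𝔸) - 1‖ ≤ P * δ₀ := by
    intro i hi x κ
    have hbase : (1 : ℝ) ≤ 8 * ((d : ℝ) + 1) * L := by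
      nlinarith [show (1 : ℝ) ≤ L by exact_mod_cast hL, show (0 : ℝ) ≤ d from Nat.cast_nonneg d]
    have hPi : (8 * ((d : ℝ) + 1) * L) ^ i ≤ P := by rw [hP]; exact pow_le_pow_right₀ hbase hi.le
    have hcond : (8 * ((d : ℝ) + 1) * L) ^ i * δ₀ ≤ 1 / 32 := (mul_le_mul_of_nonneg_right hPi hδ0).trans hδ₀32
    exact (B7Eq43AveragedSmallness.norm_avgIter_sub_one_le L hL hδ0 hδ i hcond x κ).trans (mul_le_mul_of_nonneg_right hPi hδ0)
  have hPδ0 : 0 ≤ P * δ₀ := by positivity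
  -- the curved multiplier, restricted to the restriction sets
  obtain ⟨μ, hμ⟩ := hLan
  obtain ⟨μ', hμ'def⟩ : ∃ μ' : ℕ → Site d → 𝔸, μ' = fun j y => if j ≤ m ∧ y ∈ cubeLamS L a M ρ k m j then μ j y else 0 :=
    ⟨_, rfl⟩
  have hμ'app : ∀ (j : ℕ) (y : Site d), μ' j y = if j ≤ m ∧ y ∈ cubeLamS L a M ρ k m j then μ j y else 0 :=
    fun j y => by rw [hμ'def]
  have hμ'eq : ∀ j, j ≤ m → ∀ y ∈ cubeLamS L a M ρ k m j, μ j y = μ' j y := fun j hj y hy => by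
    rw [hμ'app, if_pos ⟨hj, hy⟩]
  have hres : ∀ x ∈ cubeFam false L a M ρ k 0,
      covLap η U₀ ((cubeFam false L a M ρ k 0).indicator (covDivB η U₀ φ)) x = QT L m (cubeLamS L a M ρ k m) U₀ μ' x := by
    intro x hx
    rw [hμ x hx, QT_congr_on L m _ U₀ hμ'eq x]
  -- the two sup-substitutes: `Tφ` (sum of `‖φ‖` over the side-touching bonds) and `Tμ` (sum of `‖μ′‖` over the restriction sets)
  obtain ⟨Tφ, hTφ⟩ : ∃ Tφ : ℝ, Tφ = ∑ q ∈ TS, ‖φ q.2.1 q.2.2‖ := ⟨_, rfl⟩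
  obtain ⟨Tμ, hTμ⟩ : ∃ Tμ : ℝ, Tμ = ∑ p ∈ TM, ‖μ' p.1 p.2‖ := ⟨_, rfl⟩
  have hTφ0 : 0 ≤ Tφ := by rw [hTφ]; exact Finset.sum_nonneg fun _ _ => norm_nonneg _
  have hTμ0 : 0 ≤ Tμ := by rw [hTμ]; exact Finset.sum_nonneg fun _ _ => norm_nonneg _
  have hφle : ∀ (y : Site d) (τ : Fin d), ‖φ y τ‖ ≤ Tφ := by
    intro y τ
    by_cases h : ∃ j, j ≤ m ∧ SideTouches (cubeFam false L a M ρ k j) y τ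
    · obtain ⟨j, hj, hst⟩ := h
      rw [hTφ]
      exact Finset.single_le_sum (f := fun q : ℕ × (Site d × Fin d) => ‖φ q.2.1 q.2.2‖) (fun _ _ => norm_nonneg _) (memTS hj hst)
    · push Not at h
      rw [hs y τ fun j hj hst => h j hj hst, norm_zero]; exact hTφ0
  have hμ'le : ∀ (j : ℕ) (y : Site d), ‖μ' j y‖ ≤ Tμ := by
    intro j y
    by_cases h : j ≤ m ∧ y ∈ cubeLamS L a M ρ k m j
    · rw [hTμ]
      exact Finset.single_le_sum (f := fun p : ℕ × Site d => ‖μ' p.1 p.2‖) (fun _ _ => norm_nonneg _) (memTM h.1 h.2)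
    · have : μ' j y = 0 := by
        rw [hμ'app, if_neg h]
      rw [this, norm_zero]; exact hTμ0
  have hiEta : ∀ (y : Site d) (κ : Fin d), ‖iEta η φ y κ‖ ≤ η * Tφ := fun y κ => B8Eq146AExpansion.norm_iEta_le hη.le hφle y κ
  -- weights at `j ≤ m`
  have hwj : ∀ j, j ≤ m → (L : ℝ) ^ j * η ≤ (L : ℝ) ^ m * η := fun j hj =>
    mul_le_mul_of_nonneg_right (pow_le_pow_right₀ hL1 hj) hη0
  have hwj0 : ∀ j : ℕ, 0 ≤ (L : ℝ) ^ j * η := fun j => by positivity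
  -- the flat data of `(φ, μ′)` with the bound `N′ = N + C₀δ₀(Tφ + Tμ)`
  obtain ⟨X, hX⟩ : ∃ X : ℝ, X = Tφ + Tμ := ⟨_, rfl⟩
  have hX0 : 0 ≤ X := by rw [hX]; positivity
  have hTφX : Tφ ≤ X := by rw [hX]; linarith
  have hTμX : Tμ ≤ X := by rw [hX]; linarith
  obtain ⟨N', hN'⟩ : ∃ N' : ℝ, N' = N + C₀ * δ₀ * X := ⟨_, rfl⟩
  have hN'0 : 0 ≤ N' := by rw [hN']; positivity
  have hC₁le : C₁ ≤ C₀ := by rw [hC₀]; linarith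
  have hC₂le : C₂ ≤ C₀ := by rw [hC₀]; linarith
  have hC₁X : C₁ * δ₀ * Tφ ≤ C₀ * δ₀ * X := by gcongr
  have hsum : C₁ * δ₀ * Tφ + C₂ * δ₀ * Tμ ≤ C₀ * δ₀ * X := by
    have a1 : C₁ * δ₀ * Tφ ≤ C₁ * δ₀ * X := by gcongr
    have a2 : C₂ * δ₀ * Tμ ≤ C₂ * δ₀ * X := by gcongr
    have e : C₁ * δ₀ * X + C₂ * δ₀ * X = C₀ * δ₀ * X := by rw [hC₀]; ring
    linarith
  -- (o) the flat Landau residual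
  have h0' : ∀ x ∈ cubeFam false L a M ρ k 0,
      ‖covLap η (1 : Site d → Fin d → 𝔸ˣ) ((cubeFam false L a M ρ k 0).indicator (covDivB η (1 : Site d → Fin d → 𝔸ˣ) φ)) x
        - QT L m (cubeLamS L a M ρ k m) (1 : Site d → Fin d → 𝔸ˣ) μ' x‖ ≤ N' := by
    intro x hx
    have e : covLap η (1 : Site d → Fin d → 𝔸ˣ) ((cubeFam false L a M ρ k 0).indicator (covDivB η (1 : Site d → Fin d → 𝔸ˣ) φ)) x
        - QT L m (cubeLamS L a M ρ k m) (1 : Site d → Fin d → 𝔸ˣ) μ' x =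
        -(covLap η U₀ ((cubeFam false L a M ρ k 0).indicator (covDivB η U₀ φ)) x
            - covLap η (1 : Site d → Fin d → 𝔸ˣ) ((cubeFam false L a M ρ k 0).indicator (covDivB η (1 : Site d → Fin d → 𝔸ˣ) φ)) x)
          + (QT L m (cubeLamS L a M ρ k m) U₀ μ' x - QT L m (cubeLamS L a M ρ k m) (1 : Site d → Fin d → 𝔸ˣ) μ' x) := by
      rw [← hres x hx]; abel
    rw [e]
    have hA := norm_landauStencil_sub_flat_le hU hδ hη hδ0 (cubeFam false L a M ρ k 0) hTφ0 hφle x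
    have hQ := norm_QT_sub_flat_le hL hPδ0 hUi hεi (cubeLamS L a M ρ k m) μ' hTμ0 (fun j _ y _ => hμ'le j y) x
    refine (norm_add_le _ _).trans ?_
    rw [norm_neg]
    refine (add_le_add hA hQ).trans ?_
    have hc1 : 24 * (d : ℝ) ^ 2 * (η ^ 3)⁻¹ ≤ C₁ := by
      rw [hC₁]
      have t1 : 0 ≤ ((L : ℝ) ^ m * η) ^ 3 * (32 * d * (η ^ 2)⁻¹) := by positivity
      have t2 : 0 ≤ (m : ℝ) * (102 * ((d : ℝ) + 1) ^ 2 * L * P) * (2 * (L : ℝ)) ^ m * η := by positivity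
      linarith
    have e1 : 24 * (d : ℝ) ^ 2 * (η ^ 3)⁻¹ * δ₀ * Tφ ≤ C₁ * δ₀ * Tφ := by gcongr
    have e2 : (m : ℝ) * (m + 1) * (2 * (d * L * (P * δ₀))) * Tμ = C₂ * δ₀ * Tμ := by rw [hC₂]; ring
    rw [e2, hN']
    linarith [e1, hsum]
  -- (i) the flat current
  have hpow3 : ∀ j, j ≤ m → ((L : ℝ) ^ j * η) ^ 3 ≤ ((L : ℝ) ^ m * η) ^ 3 := fun j hj => pow_le_pow_left₀ (hwj0 j) (hwj j hj) 3
  have hpow2 : ∀ j, j ≤ m → ((L : ℝ) ^ j * η) ^ 2 ≤ ((L : ℝ) ^ m * η) ^ 2 := fun j hj => pow_le_pow_left₀ (hwj0 j) (hwj j hj) 2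
  have hJC₁ : ((L : ℝ) ^ m * η) ^ 3 * (32 * d * (η ^ 2)⁻¹) ≤ C₁ := by
    rw [hC₁]
    have t1 : 0 ≤ 24 * (d : ℝ) ^ 2 * (η ^ 3)⁻¹ := by positivity
    have t2 : 0 ≤ (m : ℝ) * (102 * ((d : ℝ) + 1) ^ 2 * L * P) * (2 * (L : ℝ)) ^ m * η := by positivity
    linarith
  have hQC₁ : (m : ℝ) * (102 * ((d : ℝ) + 1) ^ 2 * L * P) * (2 * (L : ℝ)) ^ m * η ≤ C₁ := by
    rw [hC₁]
    have t1 : 0 ≤ 24 * (d : ℝ) ^ 2 * (η ^ 3)⁻¹ := by positivity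
    have t2 : 0 ≤ ((L : ℝ) ^ m * η) ^ 3 * (32 * d * (η ^ 2)⁻¹) := by positivity
    linarith
  have h1' : ∀ j, j ≤ m → ∀ (y : Site d) (τ : Fin d), BondTouches (cubeFam false L a M ρ k j) y τ →
      ((L : ℝ) ^ j * η) ^ 3 * ‖Jcur η (1 : Site d → Fin d → 𝔸ˣ) φ τ y‖ ≤ N' := by
    intro j hj y τ hbt
    have hJ := norm_Jcur_sub_flat_le hU hδ hη hTφ0 hφle τ y
    have hflat : ‖Jcur η (1 : Site d → Fin d → 𝔸ˣ) φ τ y‖ ≤ ‖Jcur η U₀ φ τ y‖ + 32 * d * (η ^ 2)⁻¹ * δ₀ * Tφ :=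
      (norm_le_insert _ _).trans (add_le_add le_rfl hJ)
    have hw3 : 0 ≤ ((L : ℝ) ^ j * η) ^ 3 := pow_nonneg (hwj0 j) 3
    calc ((L : ℝ) ^ j * η) ^ 3 * ‖Jcur η (1 : Site d → Fin d → 𝔸ˣ) φ τ y‖
        ≤ ((L : ℝ) ^ j * η) ^ 3 * ‖Jcur η U₀ φ τ y‖ + ((L : ℝ) ^ j * η) ^ 3 * (32 * d * (η ^ 2)⁻¹ * δ₀ * Tφ) := by
          rw [← mul_add]; exact mul_le_mul_of_nonneg_left hflat hw3
      _ ≤ N + ((L : ℝ) ^ m * η) ^ 3 * (32 * d * (η ^ 2)⁻¹ * δ₀ * Tφ) :=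
          add_le_add (h1 j hj y τ hbt) (mul_le_mul_of_nonneg_right (hpow3 j hj) (by positivity))
      _ = N + (((L : ℝ) ^ m * η) ^ 3 * (32 * d * (η ^ 2)⁻¹)) * δ₀ * Tφ := by ring
      _ ≤ N + C₁ * δ₀ * Tφ := by gcongr
      _ ≤ N' := by rw [hN']; linarith [hC₁X]
  -- (ii) the flat averages over print's class
  have h2' : ∀ j, j ≤ m → ∀ c ∈ cubeLamBP L a M ρ k m j,
      ‖linCovIter L (1 : Site d → Fin d → 𝔸ˣ) (iEta η φ) j c.1 c.2‖ ≤ N' := by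
    intro j hj c hc
    have hQ := (norm_linCovIter_sub_flat_le hL hPδ0 hUi hεi hδ₀1 (by positivity) hiEta j hj).2 c.1 c.2
    have hjm : (j : ℝ) ≤ m := by exact_mod_cast hj
    have hLL : (1 : ℝ) ≤ 2 * (L : ℝ) := by nlinarith
    have hQ' : ‖linCovIter L U₀ (iEta η φ) j c.1 c.2 - linCovIter L (1 : Site d → Fin d → 𝔸ˣ) (iEta η φ) j c.1 c.2‖ ≤
        (m : ℝ) * (102 * ((d : ℝ) + 1) ^ 2 * L * (P * δ₀)) * (2 * (L : ℝ)) ^ m * (η * Tφ) := by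
      refine hQ.trans ?_
      gcongr
    have hflat : ‖linCovIter L (1 : Site d → Fin d → 𝔸ˣ) (iEta η φ) j c.1 c.2‖ ≤
        ‖linCovIter L U₀ (iEta η φ) j c.1 c.2‖ + (m : ℝ) * (102 * ((d : ℝ) + 1) ^ 2 * L * (P * δ₀)) * (2 * (L : ℝ)) ^ m * (η * Tφ) :=
      (norm_le_insert _ _).trans (add_le_add le_rfl hQ')
    calc ‖linCovIter L (1 : Site d → Fin d → 𝔸ˣ) (iEta η φ) j c.1 c.2‖
        ≤ N + (m : ℝ) * (102 * ((d : ℝ) + 1) ^ 2 * L * (P * δ₀)) * (2 * (L : ℝ)) ^ m * (η * Tφ) :=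
          hflat.trans (add_le_add (h2 j hj c hc) le_rfl)
      _ = N + ((m : ℝ) * (102 * ((d : ℝ) + 1) ^ 2 * L * P) * (2 * (L : ℝ)) ^ m * η) * δ₀ * Tφ := by ring
      _ ≤ N + C₁ * δ₀ * Tφ := by gcongr
      _ ≤ N' := by rw [hN']; linarith [hC₁X]
  -- (iii) the outer layer
  have hNN' : N ≤ N' := by
    rw [hN']
    have : 0 ≤ C₀ * δ₀ * X := by positivity
    linarith
  have h3' : ∀ (y : Site d) (τ : Fin d), ¬ BondTouches (cubeFam false L a M ρ k 0) y τ → η * ‖φ y τ‖ ≤ N' :=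
    fun y τ h => (h3 y τ h).trans hNN'
  -- the flat estimate with residual
  obtain ⟨keyφ, keyμ⟩ := H φ μ' hs N' hN'0 h0' h1' h2' h3'
  clear H h0' h1' h2' h3' hres hμ
  -- bootstrap: `X ≤ K·N′`
  have hTφle : Tφ ≤ (TS.card : ℝ) * η⁻¹ * B * N' := by
    have hq : ∀ q ∈ TS, ‖φ q.2.1 q.2.2‖ ≤ η⁻¹ * B * N' := by
      intro q hq
      have hq' : q.1 ≤ m ∧ SideTouches (cubeFam false L a M ρ k q.1) q.2.1 q.2.2 := by
        rw [hTS, Set.Finite.mem_toFinset] at hq; exact hq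
      have hb := (keyφ q.1 hq'.1 q.2.1 q.2.2 hq'.2).1
      have hwge : η ≤ (L : ℝ) ^ q.1 * η := le_mul_of_one_le_left hη0 (one_le_pow₀ hL1)
      have hη' : η * ‖φ q.2.1 q.2.2‖ ≤ B * N' := (mul_le_mul_of_nonneg_right hwge (norm_nonneg _)).trans hb
      have hηne : η ≠ 0 := hη.ne'
      have e1 : ‖φ q.2.1 q.2.2‖ = η⁻¹ * (η * ‖φ q.2.1 q.2.2‖) := by
        rw [← mul_assoc, inv_mul_cancel₀ hηne, one_mul]
      rw [e1, mul_assoc η⁻¹ B N']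
      exact mul_le_mul_of_nonneg_left hη' (inv_nonneg.2 hη0)
    calc Tφ = ∑ q ∈ TS, ‖φ q.2.1 q.2.2‖ := hTφ
      _ ≤ ∑ _q ∈ TS, η⁻¹ * B * N' := Finset.sum_le_sum hq
      _ = (TS.card : ℝ) * η⁻¹ * B * N' := by rw [Finset.sum_const, nsmul_eq_mul]; ring
  have hTμle : Tμ ≤ (TM.card : ℝ) * B * N' := by
    have hp : ∀ p ∈ TM, ‖μ' p.1 p.2‖ ≤ B * N' := by
      intro p hp
      have hp' : p.1 ≤ m ∧ p.2 ∈ cubeLamS L a M ρ k m p.1 := by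
        rw [hTM, Set.Finite.mem_toFinset] at hp; exact hp
      exact keyμ p.1 hp'.1 p.2 hp'.2
    calc Tμ = ∑ p ∈ TM, ‖μ' p.1 p.2‖ := hTμ
      _ ≤ ∑ _p ∈ TM, B * N' := Finset.sum_le_sum hp
      _ = (TM.card : ℝ) * B * N' := by rw [Finset.sum_const, nsmul_eq_mul]; ring
  have hXle : X ≤ K * N' := by
    rw [hX, hK]
    calc Tφ + Tμ ≤ (TS.card : ℝ) * η⁻¹ * B * N' + (TM.card : ℝ) * B * N' := add_le_add hTφle hTμle
      _ = ((TS.card : ℝ) * η⁻¹ * B + (TM.card : ℝ) * B) * N' := by ring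
  have hX2 : X ≤ 2 * K * N := by
    have h := hXle
    rw [hN'] at h
    have h' : K * (N + C₀ * δ₀ * X) = K * N + (K * C₀ * δ₀) * X := by ring
    rw [h'] at h
    have h'' : (K * C₀ * δ₀) * X ≤ (1 / 2) * X := mul_le_mul_of_nonneg_right hδ₀2 hX0
    linarith
  have hN'le : N' ≤ 2 * N := by
    rw [hN']
    have h1 : C₀ * δ₀ * X ≤ C₀ * δ₀ * (2 * K * N) := by gcongr
    have h2 : C₀ * δ₀ * (2 * K * N) = 2 * (K * C₀ * δ₀) * N := by ring
    have h3 : 2 * (K * C₀ * δ₀) * N ≤ 2 * (1 / 2) * N := by gcongr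
    linarith
  -- the targets at the curved background
  have hKN : 0 ≤ K * N := by positivity
  intro j hj y τ hst
  obtain ⟨t1, t2, t3⟩ := keyφ j hj y τ hst
  have hw0 : 0 ≤ (L : ℝ) ^ j * η := hwj0 j
  have hBN' : B * N' ≤ 2 * B * N := by
    calc B * N' ≤ B * (2 * N) := by gcongr
      _ = 2 * B * N := by ring
  refine ⟨?_, fun ν => ?_, ?_⟩
  · -- `(Lʲη)|φ| ≤ B N′ ≤ 2B N ≤ B′N`
    calc (L : ℝ) ^ j * η * ‖φ y τ‖ ≤ B * N' := t1
      _ ≤ 2 * B * N := hBN'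
      _ ≤ B' * N := mul_le_mul_of_nonneg_right (by linarith) hN
  · -- `(Lʲη)²|D^η_{U₀}φ| ≤ B N′ + (Lη)²·η⁻¹·2δ₀·Tφ`
    have hD := norm_covDerivFwd_sub_flat_le hU hδ hη ν (fun z => φ z τ) y
    have hflat := t2 ν
    have hcurv : ‖covDerivFwd η U₀ ν (fun z => φ z τ) y‖ ≤
        ‖covDerivFwd η (1 : Site d → Fin d → 𝔸ˣ) ν (fun z => φ z τ) y‖ + η⁻¹ * (2 * δ₀ * Tφ) :=
      (norm_le_insert' _ _).trans (add_le_add le_rfl (hD.trans (by gcongr; exact hφle _ _)))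
    have hw2 : 0 ≤ ((L : ℝ) ^ j * η) ^ 2 := pow_nonneg hw0 2
    have e : ((L : ℝ) ^ m * η) ^ 2 * (η⁻¹ * (2 * δ₀ * Tφ)) = 2 * ((L : ℝ) ^ m) ^ 2 * η * δ₀ * Tφ := by
      have hηne : η ≠ 0 := hη.ne'
      have hc : η ^ 2 * η⁻¹ = η := by rw [pow_two, mul_assoc, mul_inv_cancel₀ hηne, mul_one]
      calc ((L : ℝ) ^ m * η) ^ 2 * (η⁻¹ * (2 * δ₀ * Tφ)) = ((L : ℝ) ^ m) ^ 2 * (η ^ 2 * η⁻¹) * (2 * δ₀ * Tφ) := by ring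
        _ = 2 * ((L : ℝ) ^ m) ^ 2 * η * δ₀ * Tφ := by rw [hc]; ring
    have hrest : 2 * ((L : ℝ) ^ m) ^ 2 * η * δ₀ * Tφ ≤ (4 * ((L : ℝ) ^ m) ^ 2 * η) * (K * N) := by
      have hδT : δ₀ * Tφ ≤ 2 * K * N := by
        calc δ₀ * Tφ ≤ 1 * (2 * K * N) := by gcongr; exact hTφX.trans hX2
          _ = 2 * K * N := one_mul _
      have hc : 0 ≤ 2 * ((L : ℝ) ^ m) ^ 2 * η := by positivity
      calc 2 * ((L : ℝ) ^ m) ^ 2 * η * δ₀ * Tφ = (2 * ((L : ℝ) ^ m) ^ 2 * η) * (δ₀ * Tφ) := by ring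
        _ ≤ (2 * ((L : ℝ) ^ m) ^ 2 * η) * (2 * K * N) := mul_le_mul_of_nonneg_left hδT hc
        _ = (4 * ((L : ℝ) ^ m) ^ 2 * η) * (K * N) := by ring
    calc ((L : ℝ) ^ j * η) ^ 2 * ‖covDerivFwd η U₀ ν (fun z => φ z τ) y‖
        ≤ ((L : ℝ) ^ j * η) ^ 2 * ‖covDerivFwd η (1 : Site d → Fin d → 𝔸ˣ) ν (fun z => φ z τ) y‖
            + ((L : ℝ) ^ j * η) ^ 2 * (η⁻¹ * (2 * δ₀ * Tφ)) := by rw [← mul_add]; exact mul_le_mul_of_nonneg_left hcurv hw2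
      _ ≤ B * N' + ((L : ℝ) ^ m * η) ^ 2 * (η⁻¹ * (2 * δ₀ * Tφ)) :=
          add_le_add hflat (mul_le_mul_of_nonneg_right (hpow2 j hj) (by positivity))
      _ = B * N' + 2 * ((L : ℝ) ^ m) ^ 2 * η * δ₀ * Tφ := by rw [e]
      _ ≤ 2 * B * N + (4 * ((L : ℝ) ^ m) ^ 2 * η) * (K * N) := add_le_add hBN' hrest
      _ = (2 * B + (4 * ((L : ℝ) ^ m) ^ 2 * η) * K) * N := by ring
      _ ≤ B' * N := by
          refine mul_le_mul_of_nonneg_right ?_ hN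
          have h16 : 0 ≤ (16 * d * ((L : ℝ) ^ m) ^ 3 * η) * K := by positivity
          have hsplit : (4 * ((L : ℝ) ^ m) ^ 2 * η + 16 * d * ((L : ℝ) ^ m) ^ 3 * η) * K =
              (4 * ((L : ℝ) ^ m) ^ 2 * η) * K + (16 * d * ((L : ℝ) ^ m) ^ 3 * η) * K := by ring
          linarith
  · -- `(Lʲη)³|Δ^η_{U₀}φ| ≤ B N′ + (Lη)³·8d·η⁻²·δ₀·Tφ`
    have hΔ := norm_covLap_sub_flat_le hU hδ hη hδ0 (g := fun z => φ z τ) (fun z => hφle z τ) y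
    have hcurv : ‖covLap η U₀ (fun z => φ z τ) y‖ ≤
        ‖covLap η (1 : Site d → Fin d → 𝔸ˣ) (fun z => φ z τ) y‖ + 8 * d * (η ^ 2)⁻¹ * δ₀ * Tφ :=
      (norm_le_insert' _ _).trans (add_le_add le_rfl hΔ)
    have hw3 : 0 ≤ ((L : ℝ) ^ j * η) ^ 3 := pow_nonneg hw0 3
    have e : ((L : ℝ) ^ m * η) ^ 3 * (8 * d * (η ^ 2)⁻¹ * δ₀ * Tφ) = 8 * d * ((L : ℝ) ^ m) ^ 3 * η * δ₀ * Tφ := by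
      have hηne : η ≠ 0 := hη.ne'
      have hc : η ^ 3 * (η ^ 2)⁻¹ = η := by
        rw [pow_succ, mul_comm (η ^ 2) η, mul_assoc, mul_inv_cancel₀ (pow_ne_zero 2 hηne), mul_one]
      calc ((L : ℝ) ^ m * η) ^ 3 * (8 * d * (η ^ 2)⁻¹ * δ₀ * Tφ) = ((L : ℝ) ^ m) ^ 3 * (η ^ 3 * (η ^ 2)⁻¹) * (8 * d * δ₀ * Tφ) := by ring
        _ = 8 * d * ((L : ℝ) ^ m) ^ 3 * η * δ₀ * Tφ := by rw [hc]; ring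
    have hrest : 8 * d * ((L : ℝ) ^ m) ^ 3 * η * δ₀ * Tφ ≤ (16 * d * ((L : ℝ) ^ m) ^ 3 * η) * (K * N) := by
      have hδT : δ₀ * Tφ ≤ 2 * K * N := by
        calc δ₀ * Tφ ≤ 1 * (2 * K * N) := by gcongr; exact hTφX.trans hX2
          _ = 2 * K * N := one_mul _
      have hc : 0 ≤ 8 * d * ((L : ℝ) ^ m) ^ 3 * η := by positivity
      calc 8 * d * ((L : ℝ) ^ m) ^ 3 * η * δ₀ * Tφ = (8 * d * ((L : ℝ) ^ m) ^ 3 * η) * (δ₀ * Tφ) := by ring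
        _ ≤ (8 * d * ((L : ℝ) ^ m) ^ 3 * η) * (2 * K * N) := mul_le_mul_of_nonneg_left hδT hc
        _ = (16 * d * ((L : ℝ) ^ m) ^ 3 * η) * (K * N) := by ring
    calc ((L : ℝ) ^ j * η) ^ 3 * ‖covLap η U₀ (fun z => φ z τ) y‖
        ≤ ((L : ℝ) ^ j * η) ^ 3 * ‖covLap η (1 : Site d → Fin d → 𝔸ˣ) (fun z => φ z τ) y‖
            + ((L : ℝ) ^ j * η) ^ 3 * (8 * d * (η ^ 2)⁻¹ * δ₀ * Tφ) := by rw [← mul_add]; exact mul_le_mul_of_nonneg_left hcurv hw3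
      _ ≤ B * N' + ((L : ℝ) ^ m * η) ^ 3 * (8 * d * (η ^ 2)⁻¹ * δ₀ * Tφ) :=
          add_le_add t3 (mul_le_mul_of_nonneg_right (hpow3 j hj) (by positivity))
      _ = B * N' + 8 * d * ((L : ℝ) ^ m) ^ 3 * η * δ₀ * Tφ := by rw [e]
      _ ≤ 2 * B * N + (16 * d * ((L : ℝ) ^ m) ^ 3 * η) * (K * N) := add_le_add hBN' hrest
      _ = (2 * B + (16 * d * ((L : ℝ) ^ m) ^ 3 * η) * K) * N := by ring
      _ ≤ B' * N := by
          refine mul_le_mul_of_nonneg_right ?_ hN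
          have h4 : 0 ≤ (4 * ((L : ℝ) ^ m) ^ 2 * η) * K := by positivity
          have hsplit : (4 * ((L : ℝ) ^ m) ^ 2 * η + 16 * d * ((L : ℝ) ^ m) ^ 3 * η) * K =
              (4 * ((L : ℝ) ^ m) ^ 2 * η) * K + (16 * d * ((L : ℝ) ^ m) ^ 3 * η) * K := by ring
          linarith


end Literature.MathematicalPhysics.QuantumFieldTheory.Balaban1983to89.B8Ineq159CurvedCubeMemberPerCubeTower

end
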